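import Literature.Geometry.Kaehler.PoincareLemmaStarConvex
import HarnessLib

/-!
# The radial homotopy operator does not lose growth (stub `stub_norm_coneOperator_le`)

Crux `HeckeEigenvalueField` (stmt-Langlands-13632), line `Sketch`, stub GROWTH-K.  For the radial
homotopy operator of `Literature.Geometry.Kaehler.PoincareLemmaFlat`,
`K_{x₀} β x = ∫₀¹ t^k • ι_{x - x₀} β (x₀ + t (x - x₀)) dt`, bounds for `β` and `Dβ` ALONG THE
SEGMENT `[x₀, x]` bound `K_{x₀} β (x)` and its derivative at `x`:

* `‖K β (x)‖ ≤ B ‖x - x₀‖` whenever `‖β‖ ≤ B` on the segment (no regularity needed: the integrand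
  has norm `≤ t^k ‖β (x₀ + t (x - x₀))‖ ‖x - x₀‖`, `coneOpGrowth_norm_coneOperator_le`);
* `‖D (K β) (x)‖ ≤ B' ‖x - x₀‖ + B` whenever moreover `‖Dβ‖ ≤ B'` on the segment and `β` is `C^∞`
  on an open set star-shaped at `x₀` containing `x`
  (`coneOpGrowth_norm_fderiv_coneOperator_le_of_contDiffOn`):
  localise by a cut-off equal to `1` near the segment
  (`exists_contDiff_coneOperator_eventuallyEq`), differentiate under the integral sign
  (`Literature.Analysis.FunctionSpaces.fderiv_parametric_intervalIntegral_apply`) and bound the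
  partial derivative `t^k • ι_h β + t^{k+1} • ι_{x - x₀} (Dβ h)` of the integrand
  (`fderiv_coneIntegrand_apply`) by `(B + B' ‖x - x₀‖) ‖h‖`.

The registered stub `stub_norm_coneOperator_le` is the conjunction of the two bounds for `β` of
class `C^∞` on `X` (`coneOpGrowth_norm_coneOperator_le_and_of_contDiffOn`); the order-`0` bound
`coneOpGrowth_norm_coneOperator_le` needs no hypothesis on `β` beyond the bound on the segment.

## References

* R. Bott, L. W. Tu, *Differential Forms in Algebraic Topology* (1982), §I.4. [BottTu1982Forms]
* J. M. Lee, *Introduction to Smooth Manifolds*, 2nd ed. (2013), Thm. 17.14. [LeeSmoothManifolds2013]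
-/

set_option linter.dupNamespace false -- project-wide: `Summit.Langlands.Langlands` is the mandated namespace

noncomputable section

namespace Summit.Langlands.Langlands.Theorems.HeckeEigenvalueField.Res

open Literature.Geometry.Kaehler Set MeasureTheory intervalIntegral Filter Topology
open scoped Topology ContDiff

/-- `‖t^m • ι_v f‖ ≤ ‖f‖ ‖v‖` for `t ∈ [0, 1]`: insertion in the first slot is an isometry onto
its image (`ContinuousAlternatingMap.norm_curryLeft`) and `0 ≤ t^m ≤ 1`. [folklore] -/
theorem coneOpGrowth_norm_smul_curryLeft_le {E : Type*} [NormedAddCommGroup E] [NormedSpace ℝ E]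
    {F : Type*} [NormedAddCommGroup F] [NormedSpace ℝ F] {n : ℕ} {t : ℝ} (ht : t ∈ Icc (0 : ℝ) 1)
    (m : ℕ) (f : E [⋀^Fin (n + 1)]→L[ℝ] F) (v : E) :
    ‖(t ^ m) • f.curryLeft v‖ ≤ ‖f‖ * ‖v‖ := by
  rw [norm_smul, norm_pow, Real.norm_eq_abs, abs_of_nonneg ht.1]
  have h1 : t ^ m ≤ 1 := pow_le_one₀ ht.1 ht.2
  have h2 : ‖f.curryLeft v‖ ≤ ‖f‖ * ‖v‖ :=
    (f.curryLeft.le_opNorm v).trans_eq (by rw [ContinuousAlternatingMap.norm_curryLeft])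
  calc t ^ m * ‖f.curryLeft v‖ ≤ 1 * ‖f.curryLeft v‖ := by gcongr
    _ ≤ ‖f‖ * ‖v‖ := by rw [one_mul]; exact h2

/-- The integrand `t^k • ι_{x - x₀} β (x₀ + t (x - x₀))` of the radial homotopy operator has norm
at most `‖β (x₀ + t (x - x₀))‖ ‖x - x₀‖` for `t ∈ [0, 1]`. [folklore] -/
theorem coneOpGrowth_norm_coneIntegrand_le {E : Type*} [NormedAddCommGroup E] [NormedSpace ℝ E]
    {F : Type*} [NormedAddCommGroup F] [NormedSpace ℝ F] {k : ℕ} (x₀ : E)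
    (β : E → E [⋀^Fin (k + 1)]→L[ℝ] F) (x : E) {t : ℝ} (ht : t ∈ Icc (0 : ℝ) 1) :
    ‖coneIntegrand x₀ β (t, x)‖ ≤ ‖β (x₀ + t • (x - x₀))‖ * ‖x - x₀‖ :=
  coneOpGrowth_norm_smul_curryLeft_le ht k _ _

/-- **`K` does not lose growth, order `0`.** If `‖β‖ ≤ B` along the segment `[x₀, x]`, then
`‖K_{x₀} β (x)‖ ≤ B ‖x - x₀‖` (the integrand has norm `≤ B ‖x - x₀‖` on `[0, 1]`; no regularity or
integrability is needed, a non-integrable integrand having integral `0`). Bott–Tu (1982), §I.4.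
[cite: BottTu1982Forms, §I.4] -/
theorem coneOpGrowth_norm_coneOperator_le {E : Type*} [NormedAddCommGroup E] [NormedSpace ℝ E]
    {F : Type*} [NormedAddCommGroup F] [NormedSpace ℝ F] {k : ℕ} {x₀ : E}
    {β : E → E [⋀^Fin (k + 1)]→L[ℝ] F} {x : E} {B : ℝ}
    (hB : ∀ t ∈ Icc (0 : ℝ) 1, ‖β (x₀ + t • (x - x₀))‖ ≤ B) :
    ‖coneOperator x₀ β x‖ ≤ B * ‖x - x₀‖ := by
  have h := intervalIntegral.norm_integral_le_of_norm_le_const (a := 0) (b := 1)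
    (C := B * ‖x - x₀‖) (f := fun t => coneIntegrand x₀ β (t, x)) fun t ht => by
      rw [uIoc_of_le zero_le_one] at ht
      have ht' : t ∈ Icc (0 : ℝ) 1 := ⟨ht.1.le, ht.2⟩
      calc ‖coneIntegrand x₀ β (t, x)‖ ≤ ‖β (x₀ + t • (x - x₀))‖ * ‖x - x₀‖ :=
            coneOpGrowth_norm_coneIntegrand_le x₀ β x ht'
        _ ≤ B * ‖x - x₀‖ := by gcongr; exact hB t ht'
  simpa [coneOperator] using h

/-- **`K` does not lose growth, order `1`, globally smooth forms.** For a `C^∞` form `β` on a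
finite-dimensional space with `‖β‖ ≤ B` and `‖Dβ‖ ≤ B'` along the segment `[x₀, x]`,
`‖D (K_{x₀} β) (x)‖ ≤ B' ‖x - x₀‖ + B`: differentiate under the integral sign
(`Literature.Analysis.FunctionSpaces.fderiv_parametric_intervalIntegral_apply`) and bound the
partial derivative `t^k • ι_h β + t^{k+1} • ι_{x - x₀} (Dβ h)` of the integrand
(`fderiv_coneIntegrand_apply`) by `(B + B' ‖x - x₀‖) ‖h‖`. Bott–Tu (1982), §I.4.
[cite: BottTu1982Forms, §I.4] -/
theorem coneOpGrowth_norm_fderiv_coneOperator_le_of_contDiff {E : Type*} [NormedAddCommGroup E]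
    [NormedSpace ℝ E] [FiniteDimensional ℝ E] {F : Type*} [NormedAddCommGroup F] [NormedSpace ℝ F]
    {k : ℕ} {x₀ : E} {β : E → E [⋀^Fin (k + 1)]→L[ℝ] F} (hβ : ContDiff ℝ ∞ β) {x : E} {B B' : ℝ}
    (hB : ∀ t ∈ Icc (0 : ℝ) 1, ‖β (x₀ + t • (x - x₀))‖ ≤ B)
    (hB' : ∀ t ∈ Icc (0 : ℝ) 1, ‖fderiv ℝ β (x₀ + t • (x - x₀))‖ ≤ B') :
    ‖fderiv ℝ (coneOperator x₀ β) x‖ ≤ B' * ‖x - x₀‖ + B := by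
  have hinf : (∞ : WithTop ℕ∞) ≠ 0 := by simp
  have hH : ContDiff ℝ ∞ (coneIntegrand x₀ β) := contDiff_coneIntegrand x₀ hβ
  have hB0 : 0 ≤ B := (norm_nonneg _).trans (hB 0 (left_mem_Icc.2 zero_le_one))
  have hB'0 : 0 ≤ B' :=
    (norm_nonneg (fderiv ℝ β (x₀ + (0 : ℝ) • (x - x₀)))).trans (hB' 0 (left_mem_Icc.2 zero_le_one))
  refine ContinuousLinearMap.opNorm_le_bound _ (by positivity) fun h => ?_
  -- the derivative in the direction `h`, under the integral sign
  have hKd : fderiv ℝ (coneOperator x₀ β) x h =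
      ∫ σ in (0 : ℝ)..1, fderiv ℝ (coneIntegrand x₀ β) (σ, x) ((0 : ℝ), h) :=
    Literature.Analysis.FunctionSpaces.fderiv_parametric_intervalIntegral_apply hH hinf 0 1 x h
  -- the partial derivative in `x` of the integrand
  have hDH : ∀ σ : ℝ, fderiv ℝ (coneIntegrand x₀ β) (σ, x) ((0 : ℝ), h) =
      (σ ^ k) • (β (x₀ + σ • (x - x₀))).curryLeft h +
        (σ ^ (k + 1)) • (fderiv ℝ β (x₀ + σ • (x - x₀)) h).curryLeft (x - x₀) := by
    intro σ
    rw [← fderiv_coneIntegrand_apply x₀ hβ σ x h,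
      (Literature.Analysis.FunctionSpaces.hasFDerivAt_comp_prodMk hH hinf σ x).fderiv]
    rfl
  have hI := intervalIntegral.norm_integral_le_of_norm_le_const (a := 0) (b := 1)
    (C := (B' * ‖x - x₀‖ + B) * ‖h‖)
    (f := fun σ => fderiv ℝ (coneIntegrand x₀ β) (σ, x) ((0 : ℝ), h)) fun σ hσ => by
      rw [uIoc_of_le zero_le_one] at hσ
      have hσ' : σ ∈ Icc (0 : ℝ) 1 := ⟨hσ.1.le, hσ.2⟩
      have h1 : ‖(σ ^ k) • (β (x₀ + σ • (x - x₀))).curryLeft h‖ ≤ B * ‖h‖ :=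
        (coneOpGrowth_norm_smul_curryLeft_le hσ' k _ h).trans (by gcongr; exact hB σ hσ')
      have h2 : ‖(σ ^ (k + 1)) • (fderiv ℝ β (x₀ + σ • (x - x₀)) h).curryLeft (x - x₀)‖ ≤
          B' * ‖h‖ * ‖x - x₀‖ := by
        refine (coneOpGrowth_norm_smul_curryLeft_le hσ' (k + 1) _ (x - x₀)).trans ?_
        gcongr
        exact ((fderiv ℝ β (x₀ + σ • (x - x₀))).le_opNorm h).trans (by gcongr; exact hB' σ hσ')
      rw [hDH σ]
      calc _ ≤ ‖(σ ^ k) • (β (x₀ + σ • (x - x₀))).curryLeft h‖ +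
            ‖(σ ^ (k + 1)) • (fderiv ℝ β (x₀ + σ • (x - x₀)) h).curryLeft (x - x₀)‖ :=
          norm_add_le _ _
        _ ≤ B * ‖h‖ + B' * ‖h‖ * ‖x - x₀‖ := add_le_add h1 h2
        _ = (B' * ‖x - x₀‖ + B) * ‖h‖ := by ring
  rw [hKd]
  simpa using hI

/-- **`K` does not lose growth, order `1`, forms smooth on a star-shaped open set.** For `β` of
class `C^∞` on an open set `X` star-shaped at `x₀`, `x ∈ X`, `‖β‖ ≤ B` and `‖Dβ‖ ≤ B'` along the
segment `[x₀, x]`: `‖D (K_{x₀} β) (x)‖ ≤ B' ‖x - x₀‖ + B`. Localise by a cut-off equal to `1` near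
the segment (`exists_contDiff_coneOperator_eventuallyEq`: a globally `C^∞` form with the same
values and derivatives along the segment and the same `K` near `x`) and apply
`coneOpGrowth_norm_fderiv_coneOperator_le_of_contDiff`. Bott–Tu (1982), §I.4; Lee (2013),
Thm. 17.14.
[cite: BottTu1982Forms, §I.4] -/
theorem coneOpGrowth_norm_fderiv_coneOperator_le_of_contDiffOn {E : Type*} [NormedAddCommGroup E]
    [NormedSpace ℝ E] [FiniteDimensional ℝ E] {F : Type*} [NormedAddCommGroup F] [NormedSpace ℝ F]
    {k : ℕ} {X : Set E} {x₀ : E} (hXo : IsOpen X) (hst : StarConvex ℝ x₀ X)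
    {β : E → E [⋀^Fin (k + 1)]→L[ℝ] F} (hβ : ContDiffOn ℝ ∞ β X) {x : E} (hx : x ∈ X) {B B' : ℝ}
    (hB : ∀ t ∈ Icc (0 : ℝ) 1, ‖β (x₀ + t • (x - x₀))‖ ≤ B)
    (hB' : ∀ t ∈ Icc (0 : ℝ) 1, ‖fderiv ℝ β (x₀ + t • (x - x₀))‖ ≤ B') :
    ‖fderiv ℝ (coneOperator x₀ β) x‖ ≤ B' * ‖x - x₀‖ + B := by
  obtain ⟨β', hβ', hseg, hK⟩ := exists_contDiff_coneOperator_eventuallyEq hXo hst hβ hx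
  have h1 : fderiv ℝ (coneOperator x₀ β) x = fderiv ℝ (coneOperator x₀ β') x :=
    Filter.EventuallyEq.fderiv_eq (hK.mono fun q hq => hq.symm)
  rw [h1]
  refine coneOpGrowth_norm_fderiv_coneOperator_le_of_contDiff hβ' (fun t ht => ?_) fun t ht => ?_
  · rw [(hseg t ht).self_of_nhds]
    exact hB t ht
  · rw [Filter.EventuallyEq.fderiv_eq (hseg t ht : β' =ᶠ[𝓝 _] β)]
    exact hB' t ht

/-- **`K` does not lose growth (`C^∞` version of the stub).** For `β` of class `C^∞` on an open
set `X` star-shaped at `x₀` and `x ∈ X`, bounds `‖β‖ ≤ B`, `‖Dβ‖ ≤ B'` along the segment `[x₀, x]`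
give `‖K β (x)‖ ≤ B ‖x - x₀‖` and `‖D (K β) (x)‖ ≤ B' ‖x - x₀‖ + B`.
[cite: BottTu1982Forms, §I.4] -/
theorem coneOpGrowth_norm_coneOperator_le_and_of_contDiffOn {E : Type*} [NormedAddCommGroup E]
    [NormedSpace ℝ E] [FiniteDimensional ℝ E] {F : Type*} [NormedAddCommGroup F] [NormedSpace ℝ F]
    {k : ℕ} {X : Set E} {x₀ : E} (hXo : IsOpen X) (hst : StarConvex ℝ x₀ X)
    {β : E → E [⋀^Fin (k + 1)]→L[ℝ] F} (hβ : ContDiffOn ℝ ∞ β X) {x : E} (hx : x ∈ X) {B B' : ℝ}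
    (hB : ∀ t ∈ Icc (0 : ℝ) 1, ‖β (x₀ + t • (x - x₀))‖ ≤ B)
    (hB' : ∀ t ∈ Icc (0 : ℝ) 1, ‖fderiv ℝ β (x₀ + t • (x - x₀))‖ ≤ B') :
    ‖coneOperator x₀ β x‖ ≤ B * ‖x - x₀‖ ∧
      ‖fderiv ℝ (coneOperator x₀ β) x‖ ≤ B' * ‖x - x₀‖ + B :=
  ⟨coneOpGrowth_norm_coneOperator_le hB,
    coneOpGrowth_norm_fderiv_coneOperator_le_of_contDiffOn hXo hst hβ hx hB hB'⟩

/-- **Stub GROWTH-K — the radial homotopy operator does not lose growth**: for `β` smooth on an open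
set star-shaped at `x₀`, bounds for `β` and `Dβ` ALONG THE SEGMENT `[x₀, x]` bound `K_{x₀} β (x)` and its
derivative at `x`: `‖Kβ(x)‖ ≤ B ‖x - x₀‖` and `‖D(Kβ)(x)‖ ≤ B' ‖x - x₀‖ + B` (differentiate under the
integral — Kaehler's `fderiv_coneIntegrand_apply` after localisation by a cut-off equal to `1` near the
segment, `exists_contDiff_coneOperator_eventuallyEq` — and `∫₀¹ tᵏ ≤ 1`).  With the polynomial gauge this
propagates polynomial `C¹` bounds through the staircase ("self-regularisation").  The smoothness
exponent `((⊤ : ℕ∞) : WithTop ℕ∞)` is `∞` (`C^∞` on `X`); this is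
`coneOpGrowth_norm_coneOperator_le_and_of_contDiffOn`. [cite: BottTu1982Forms, §I.4] -/
theorem stub_norm_coneOperator_le
    {E : Type*} [NormedAddCommGroup E] [NormedSpace ℝ E] [FiniteDimensional ℝ E]
    {F : Type*} [NormedAddCommGroup F] [NormedSpace ℝ F] [CompleteSpace F]
    {k : ℕ} {X : Set E} {x₀ : E} (hXo : IsOpen X) (hst : StarConvex ℝ x₀ X)
    {β : E → E [⋀^Fin (k + 1)]→L[ℝ] F} (hβ : ContDiffOn ℝ ((⊤ : ℕ∞) : WithTop ℕ∞) β X) {x : E} (hx : x ∈ X) {B B' : ℝ}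
    (hB : ∀ t ∈ Set.Icc (0 : ℝ) 1, ‖β (x₀ + t • (x - x₀))‖ ≤ B)
    (hB' : ∀ t ∈ Set.Icc (0 : ℝ) 1, ‖fderiv ℝ β (x₀ + t • (x - x₀))‖ ≤ B') :
    ‖coneOperator x₀ β x‖ ≤ B * ‖x - x₀‖ ∧ ‖fderiv ℝ (coneOperator x₀ β) x‖ ≤ B' * ‖x - x₀‖ + B :=
  coneOpGrowth_norm_coneOperator_le_and_of_contDiffOn hXo hst hβ hx hB hB'

end Summit.Langlands.Langlands.Theorems.HeckeEigenvalueField.Res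

end
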